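import Literature.Geometry.Lorentzian.SpacetimePositiveMassRigidityReduction
import Literature.Geometry.Lorentzian.CompleteSpacelikeImmersionCauchy
import HarnessLib

/-!
# The rigid positive energy theorem: analytic half with bounded lapse, and simple connectivity,
# suffice

Sharpening of `positive_mass_rigidity_spacetime_of_kids_of_cauchy`
(`SpacetimePositiveMassRigidityReduction.lean`), which reduced the named fact
`positive_mass_rigidity_spacetime` (Beig–Chruściel, J. Math. Phys. 37 (1996), Thm. 4.1, `m = 0`)
to three inputs: (A) the analytic half (global translational KIDs with Gram matrix `η`,
`N₀ > 0`), (SC) the simple connectivity of `Σ`, and (C) the Cauchy property of the entire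
spacelike graph produced by the developing map. Here (C) is DISCHARGED in exchange for a mild
strengthening of (A): if the lapse `N₀` of the timelike KID is **bounded** — which is what the
analytic half delivers anyway, `N₀` being continuous and asymptotic to `1` along the end
(Beig–Chruściel 1996, App. A, (A.8)–(A.11): the Sen-parallel spinor is asymptotically constant) —
then the developing map `f` has unit normal `ν = (−ε_a N_a)_a` with `ν⁰ = N₀ ≤ C`, so the
hypersurface is uniformly spacelike and, being complete, is a Cauchy hypersurface of
`(ℝ⁴, η, ∂ₜ)` (`Minkowski.exists_cauchyDevelopment_eq_spacetime_of_complete_of_time_normal_le`,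
`CompleteSpacelikeImmersionCauchy.lean`; completeness from asymptotic flatness on the sole end,
`AFEnd.isComplete_of_isAsymptoticallyFlat_of_isSoleEnd`).

* `positive_mass_rigidity_spacetime_of_kids_bounded` — **the named fact follows from (A′) and
  (SC)**: (A′) = global smooth translational KIDs `(N_a, Y_a)` with Gram matrix `η`, `N₀ > 0`
  and `N₀` bounded; (SC) = `Σ` simply connected.

Theorems only; no definitions, no named facts (the inputs are binders).

## References

* R. Beig, P. T. Chruściel, *Killing vectors in asymptotically flat space-times. I.*, J. Math.
  Phys. 37 (1996) 1939–1961, Thm. 4.1 and its proof, §4; App. A, (A.8)–(A.11).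
  [BeigChrusciel1996]
-/

noncomputable section

open Bundle Set Function Manifold
open scoped Manifold ContDiff Topology

namespace Literature.Geometry.Lorentzian

/-- **The rigid positive energy theorem from its analytic half (with bounded lapse) and the
simple connectivity of `Σ`.** Granted

* `hA` — for data satisfying the hypotheses of `positive_mass_rigidity_spacetime` (dominant
  energy, asymptotic flatness of order `1`, source decay, sole end, `E_ADM = 0`) there are global
  smooth translational KIDs `(N_a, Y_a)_{a < 4}`: `h(∇ᵥY_a, w) = −N_a k(v, w)`,
  `dN_a(v) = −k(v, Y_a)`, Gram matrix `−N_aN_b + h(Y_a, Y_b) = η_{ab}`, with `N₀ > 0` and `N₀`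
  bounded above (Beig–Chruściel 1996, App. A with Witten's equation; the bound from the
  asymptotics of the spinor);
* `hSC` — such data live on a simply connected manifold (§4, the one-end argument),

the named fact holds: the developing map of the KIDs
(`InitialDataSet.exists_minkowski_immersion_of_kids`) is a smooth map `f : X → ℝ⁴` with future
unit normal `ν`, `ν⁰ = N₀ ≤ C`, `f^*η = h`, `K_ν = k`; the data are complete
(`AFEnd.isComplete_of_isAsymptoticallyFlat_of_isSoleEnd`); so Minkowski space-time is a Cauchy
development of the data
(`Minkowski.exists_cauchyDevelopment_eq_spacetime_of_complete_of_time_normal_le`).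
[cite: BeigChrusciel1996, Thm. 4.1 and its proof, §4 and App. A] -/
theorem positive_mass_rigidity_spacetime_of_kids_bounded
    (hA : ∀ (X : Type) [TopologicalSpace X] [ChartedSpace E3 X] [IsManifold (𝓡 3) ∞ X]
      [T2Space X] [SecondCountableTopology X] [ConnectedSpace X]
      (D : InitialDataSet (𝓡 3) X) [D.metric.HasLeviCivita] (e : AFEnd X),
      D.SatisfiesDominantEnergyCondition → e.IsAsymptoticallyFlat D 1 →
      (∃ q₀, HasSourceDecay e D q₀) → e.IsSoleEnd → e.HasADMEnergy D 0 →
      ∃ (N : Fin 4 → X → ℝ) (Y : Fin 4 → Π x : X, TangentSpace (𝓡 3) x),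
        (∀ a, ContMDiff (𝓡 3) 𝓘(ℝ, ℝ) ∞ (N a)) ∧
        (∀ a, ContMDiff (𝓡 3) ((𝓡 3).prod (𝓡 3)) ∞
          fun x ↦ (TotalSpace.mk' E3 x (Y a x) : TangentBundle (𝓡 3) X)) ∧
        (∀ a (x : X) (v w : TangentSpace (𝓡 3) x),
          D.metric.val x (D.metric.leviCivita (Y a) x v) w = -(N a x * D.k x v w)) ∧
        (∀ a (x : X) (v : TangentSpace (𝓡 3) x),
          mvfderiv (𝓡 3) (N a) x v = -(D.k x v (Y a x))) ∧
        (∀ (x : X) a b, -(N a x * N b x) + D.h.inner x (Y a x) (Y b x) =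
          if a = b then (if a = 0 then -1 else 1) else 0) ∧
        (∀ x, 0 < N 0 x) ∧ ∃ C : ℝ, ∀ x, N 0 x ≤ C)
    (hSC : ∀ (X : Type) [TopologicalSpace X] [ChartedSpace E3 X] [IsManifold (𝓡 3) ∞ X]
      [T2Space X] [SecondCountableTopology X] [ConnectedSpace X]
      (D : InitialDataSet (𝓡 3) X) [D.metric.HasLeviCivita] (e : AFEnd X),
      D.SatisfiesDominantEnergyCondition → e.IsAsymptoticallyFlat D 1 →
      (∃ q₀, HasSourceDecay e D q₀) → e.IsSoleEnd → e.HasADMEnergy D 0 → SimplyConnectedSpace X) :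
    positive_mass_rigidity_spacetime := by
  intro X _ _ _ _ _ _ D _ e hdec haf hsrc hsole hE
  obtain ⟨N, Y, hN, hY, hDY, hdN, hG, hN0, C, hC⟩ := hA X D e hdec haf hsrc hsole hE
  haveI : SimplyConnectedSpace X := hSC X D e hdec haf hsrc hsole hE
  obtain ⟨f, ν, hfi, hun, -, -, hν, hind, hK⟩ :=
    D.exists_minkowski_immersion_of_kids N Y hN hY hDY hdN hG hN0
  have hc : D.IsComplete := AFEnd.isComplete_of_isAsymptoticallyFlat_of_isSoleEnd one_pos haf hsole
  have hf : ContMDiff (𝓡 3) 𝓘(ℝ, E4) ∞ f :=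
    PseudoRiemannianMetric.IsSpacelikeImmersion.contMDiff_self hfi
  have hh : ∀ y : X, pullbackBilin (I := 𝓘(ℝ, E4)) (I' := 𝓡 3) f Minkowski.smoothMetric.val y =
      D.h.inner y := fun y ↦
    ContinuousLinearMap.ext fun v ↦ ContinuousLinearMap.ext fun w ↦ hind y v w
  have hk : ∀ [Minkowski.smoothMetric.toPseudoRiemannianMetric.HasLeviCivita] (y : X),
      Minkowski.smoothMetric.toPseudoRiemannianMetric.secondFundamentalForm (𝓡 3) f ν y =
        D.kBilin y := by
    intro inst y
    exact LinearMap.ext fun v ↦ LinearMap.ext fun w ↦ by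
      rw [InitialDataSet.kBilin_apply]
      exact @hK inst y v w
  have htime : ∀ x, E4.time (ν x) ≤ C := fun x ↦ by
    rw [hν x, E4.time_apply]
    simpa using hC x
  exact Minkowski.exists_cauchyDevelopment_eq_spacetime_of_complete_of_time_normal_le D hc hf ν
    hun hh hk htime

end Literature.Geometry.Lorentzian

end
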